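import Literature.Probability.RandomPlanarGeometry.LSW2004USTDriving
import Literature.Probability.RandomPlanarGeometry.USTPeanoLocal
import Literature.Probability.RandomPlanarGeometry.LoopSpaceMaps
import Literature.Topology.PlaneTopology.Crosscut
import HarnessLib

/-!
# [LSW04] §4.3: the boundary loop of a grid approximation `D^R`, matched to the boundary loop of `D`

G. F. Lawler, O. Schramm, W. Werner, *Conformal invariance of planar loop-erased random walks and
uniform spanning trees*, Ann. Probab. **32** (2004) 939–995 (**[LSW04]**), §4.3, p. 977: the grid
approximations `D^R = D(α^R, β^R, a^R, b^R) ∈ 𝔇*` of `(RD, Rα_D, Rβ_D)` satisfy `ρ(α^R, Rα_D) ≤ C`,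
`ρ(β^R, Rβ_D) ≤ C` (`C = 10`), `ρ` the reparametrisation distance of paths (the tree's
`USTPeano.IsApproximation`). LSW then use "`lim_{R → ∞} R⁻¹ φ_R⁻¹ = φ⁻¹` uniformly in `ℍ̄` (this
follows, e.g., from Cor. 2.4 in [Pommerenke 1992])". The tree has Radó's theorem in Pommerenke's
form Thm. 2.11 (`JordanDomain.rado_tendstoUniformlyOn_holds`, `RadoConvergenceProofs.lean`), whose
hypothesis is the UNIFORM CONVERGENCE OF THE BOUNDARY PARAMETRISATIONS (same parameter). This file
supplies that hypothesis for the approximations: it is elementary but not formal-trivial, because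
the boundary polygon of `D^R` (`polygonLoop (boundaryVerts …)`, uniform speed per edge) has to be
REPARAMETRISED compatibly with the boundary loop of `D`.

Main result (theorems only, no definitions):

* `USTPeano.IsApproximation.exists_jordanDomain` — for an approximation `D^R` at a scale `R` with
  `R |a - b| > 22` there is a Jordan-domain structure `E` on `R⁻¹ D^R` (carrier `R⁻¹ D^R`) whose
  boundary loop satisfies `dist (E.boundary t) (γ_D t) ≤ 14 / R` for ALL `t`, `γ_D` the boundary
  loop of `D`. Construction: traverse the boundary polygon `a^R → α^R → b^R → (β^R)⁻ → a^R` through a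
  map `Θ₀` of the period `[m₀, m₀ + 1]` (`m₀ < m₁` the marks of `a`, `b` on `γ_D`) which, on
  `[m₀ + κ, m₁ - κ]`, is the inverse of a reparametrisation realising `ρ(α^R, Rα_D) < 11` (so that
  the polygon point is within `11` of `R γ_D` up to a parameter error `≤ κ`), similarly on
  `[m₁ + κ, m₀ + 1 - κ]` with `β^R` reversed, and affine on the three junction windows of
  half-width `κ` around `a^R`, `b^R` (where the polygon is within `1` of `a^R`, resp. `b^R`, which
  are within `12` of `R a`, `R b`); `κ` is chosen with `R · osc_{κ}(γ_D) ≤ 1` (uniform continuity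
  of `γ_D`). The map is extended to `ℝ` commuting with the unit translation; the loop is then
  continuous, `1`-periodic, injective on a period (the polygon is simple) and has the same range.
* on the way: `IsApproximation.dist_peanoPt_a_le`, `IsApproximation.dist_peanoPt_b_le`
  (`|a^R - R a| ≤ 12`, `|b^R - R b| ≤ 12`), polyline bookkeeping (`polygonLoop_block`: the closed
  polygon on a block of consecutive vertices is the polyline of that block; `affineInterp_reverse`),
  and the periodic extension / gluing lemmas for increasing maps (`continuous_floor_add_comp_fract`,
  `strictMono_floor_add_comp_fract`, `continuousOn_ite_Icc`, `strictMonoOn_ite_Icc`,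
  `exists_matchingMap`).

The consumer is `LSW2004USTRado.lean` (the convergence `R⁻¹ φ_R⁻¹ → φ⁻¹` of the normalised maps,
[LSW04] p. 977, via Radó's theorem).

## References

* [LSW04] §4.3, p. 977 [LawlerSchrammWerner2004].
* Ch. Pommerenke, *Boundary Behaviour of Conformal Maps* (1992), Thm. 2.11, Cor. 2.4
  [PommerenkeBBCM1992].
-/

noncomputable section

open Set Function Filter Metric Complex
open _root_.Topology

namespace Literature.Probability.RandomPlanarGeometry

/-! ### Periodic extension of an increasing map of one period -/

section PeriodicExtension

variable {m₀ : ℝ} {Θ₀ : ℝ → ℝ}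

/-- The extension `u ↦ ⌊u - m₀⌋ + Θ₀ (m₀ + fract (u - m₀))` of a map of the period `[m₀, m₀ + 1]`
commutes with the unit translation. [folklore] -/
theorem floor_add_comp_fract_add_one (u : ℝ) :
    (⌊u + 1 - m₀⌋ : ℝ) + Θ₀ (m₀ + Int.fract (u + 1 - m₀)) =
      (⌊u - m₀⌋ : ℝ) + Θ₀ (m₀ + Int.fract (u - m₀)) + 1 := by
  rw [show u + 1 - m₀ = (u - m₀) + 1 by ring, Int.floor_add_one, Int.fract_add_one]
  push_cast
  ring

/-- The extension commutes with integer translations. [folklore] -/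
theorem floor_add_comp_fract_add_int (u : ℝ) (z : ℤ) :
    (⌊u + z - m₀⌋ : ℝ) + Θ₀ (m₀ + Int.fract (u + z - m₀)) =
      (⌊u - m₀⌋ : ℝ) + Θ₀ (m₀ + Int.fract (u - m₀)) + z := by
  rw [show u + z - m₀ = (u - m₀) + z by ring, Int.floor_add_intCast, Int.fract_add_intCast]
  push_cast
  ring

/-- On the fundamental period the extension is the given map. [folklore] -/
theorem floor_add_comp_fract_of_mem_Ico {u : ℝ} (hu : u ∈ Ico m₀ (m₀ + 1)) :
    (⌊u - m₀⌋ : ℝ) + Θ₀ (m₀ + Int.fract (u - m₀)) = Θ₀ u := by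
  have h0 : ⌊u - m₀⌋ = 0 := Int.floor_eq_zero_iff.2 ⟨by linarith [hu.1], by linarith [hu.2]⟩
  rw [Int.fract, h0]
  simp

/-- **Continuity of the periodic extension** of a map `Θ₀` continuous on `[m₀, m₀ + 1]` with
`Θ₀ m₀ = 0`, `Θ₀ (m₀ + 1) = 1`: write it as `(u - m₀) + g (fract (u - m₀))` with
`g x = Θ₀ (m₀ + x) - x`, `g 0 = g 1`. [folklore] -/
theorem continuous_floor_add_comp_fract (hc : ContinuousOn Θ₀ (Icc m₀ (m₀ + 1))) (h0 : Θ₀ m₀ = 0)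
    (h1 : Θ₀ (m₀ + 1) = 1) :
    Continuous fun u : ℝ ↦ (⌊u - m₀⌋ : ℝ) + Θ₀ (m₀ + Int.fract (u - m₀)) := by
  set g : ℝ → ℝ := fun x ↦ Θ₀ (m₀ + x) - x with hg
  have hgc : ContinuousOn g (Icc 0 1) := by
    refine ContinuousOn.sub (hc.comp (continuous_const.add continuous_id).continuousOn ?_)
      continuousOn_id
    intro x hx
    exact ⟨by linarith [hx.1], by linarith [hx.2]⟩
  have hg01 : g 0 = g 1 := by simp [hg, h0, h1]
  have hcomp : Continuous (g ∘ Int.fract) := hgc.comp_fract'' hg01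
  have heq : (fun u : ℝ ↦ (⌊u - m₀⌋ : ℝ) + Θ₀ (m₀ + Int.fract (u - m₀))) =
      fun u ↦ (u - m₀) + (g ∘ Int.fract) (u - m₀) := by
    ext u
    simp only [hg, Function.comp_apply]
    have := Int.floor_add_fract (u - m₀)
    linarith
  rw [heq]
  exact (continuous_id.sub continuous_const).add (hcomp.comp (continuous_id.sub continuous_const))

/-- **Strict monotonicity of the periodic extension** of a strictly increasing map of the period
with `Θ₀ m₀ = 0`, `Θ₀ (m₀ + 1) = 1`. [folklore] -/
theorem strictMono_floor_add_comp_fract (hm : StrictMonoOn Θ₀ (Icc m₀ (m₀ + 1))) (h0 : Θ₀ m₀ = 0)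
    (h1 : Θ₀ (m₀ + 1) = 1) :
    StrictMono fun u : ℝ ↦ (⌊u - m₀⌋ : ℝ) + Θ₀ (m₀ + Int.fract (u - m₀)) := by
  have hrange : ∀ x : ℝ, 0 ≤ Θ₀ (m₀ + Int.fract x) ∧ Θ₀ (m₀ + Int.fract x) < 1 := by
    intro x
    have h0' := Int.fract_nonneg x
    have h1' := Int.fract_lt_one x
    have hmem : m₀ + Int.fract x ∈ Icc m₀ (m₀ + 1) := ⟨by linarith, by linarith⟩
    constructor
    · rw [← h0]
      exact hm.monotoneOn (left_mem_Icc.2 (by linarith)) hmem (by linarith)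
    · rw [← h1]
      exact hm hmem (right_mem_Icc.2 (by linarith)) (by linarith)
  intro u v huv
  simp only
  have hfu := hrange (u - m₀)
  have hfv := hrange (v - m₀)
  rcases lt_or_eq_of_le (Int.floor_mono (by linarith : u - m₀ ≤ v - m₀)) with hlt | heq
  · have : (⌊u - m₀⌋ : ℝ) + 1 ≤ ⌊v - m₀⌋ := by exact_mod_cast hlt
    linarith [hfu.2, hfv.1]
  · rw [heq]
    have hfract : Int.fract (u - m₀) < Int.fract (v - m₀) := by
      have h1' := Int.floor_add_fract (u - m₀)
      have h2' := Int.floor_add_fract (v - m₀)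
      have : (⌊u - m₀⌋ : ℝ) = ⌊v - m₀⌋ := by exact_mod_cast heq
      linarith
    have hmemu : m₀ + Int.fract (u - m₀) ∈ Icc m₀ (m₀ + 1) :=
      ⟨by linarith [Int.fract_nonneg (u - m₀)], by linarith [Int.fract_lt_one (u - m₀)]⟩
    have hmemv : m₀ + Int.fract (v - m₀) ∈ Icc m₀ (m₀ + 1) :=
      ⟨by linarith [Int.fract_nonneg (v - m₀)], by linarith [Int.fract_lt_one (v - m₀)]⟩
    have := hm hmemu hmemv (by linarith)
    linarith

/-- **Surjectivity of the periodic extension** (continuity and the intermediate value theorem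
between consecutive integers). [folklore] -/
theorem surjective_floor_add_comp_fract (hc : ContinuousOn Θ₀ (Icc m₀ (m₀ + 1))) (h0 : Θ₀ m₀ = 0)
    (h1 : Θ₀ (m₀ + 1) = 1) :
    Surjective fun u : ℝ ↦ (⌊u - m₀⌋ : ℝ) + Θ₀ (m₀ + Int.fract (u - m₀)) := by
  have hcont := continuous_floor_add_comp_fract hc h0 h1
  set T : ℝ → ℝ := fun u : ℝ ↦ (⌊u - m₀⌋ : ℝ) + Θ₀ (m₀ + Int.fract (u - m₀)) with hT
  have hm0 : T m₀ = 0 := by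
    simp only [hT]
    rw [floor_add_comp_fract_of_mem_Ico ⟨le_rfl, by linarith⟩, h0]
  have hint : ∀ z : ℤ, T (m₀ + z) = z := fun z ↦ by
    have := floor_add_comp_fract_add_int (m₀ := m₀) (Θ₀ := Θ₀) m₀ z
    simp only [hT] at hm0 ⊢
    rw [this, hm0, zero_add]
  intro y
  have hle : T (m₀ + ⌊y⌋) ≤ y := by rw [hint]; exact Int.floor_le y
  have hge : y ≤ T (m₀ + (⌊y⌋ + 1 : ℤ)) := by
    rw [hint]; push_cast; exact (Int.lt_floor_add_one y).le
  obtain ⟨u, -, hu⟩ := intermediate_value_Icc (by push_cast; linarith) hcont.continuousOn ⟨hle, hge⟩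
  exact ⟨u, hu⟩

end PeriodicExtension

/-! ### Gluing increasing continuous pieces -/

section Glue

variable {f g : ℝ → ℝ} {a b c : ℝ}

/-- Gluing two continuous functions at a point where they agree. [folklore] -/
theorem continuousOn_ite_Icc (hf : ContinuousOn f (Icc a b)) (hg : ContinuousOn g (Icc b c))
    (hfg : f b = g b) : ContinuousOn (fun u ↦ if u ≤ b then f u else g u) (Icc a c) := by
  refine ContinuousOn.if ?_ ?_ ?_
  · rintro u ⟨-, hu⟩
    have hu' : u ∈ frontier (Iic b) := hu
    rw [frontier_Iic] at hu'
    rw [mem_singleton_iff.1 hu', hfg]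
  · have e : closure {u : ℝ | u ≤ b} = Iic b := closure_Iic b
    rw [e]
    exact hf.mono fun u hu ↦ ⟨hu.1.1, hu.2⟩
  · have e : closure {u : ℝ | ¬u ≤ b} = Ici b := by
      rw [show {u : ℝ | ¬u ≤ b} = Ioi b from Set.ext fun u ↦ not_le]
      exact closure_Ioi b
    rw [e]
    exact hg.mono fun u hu ↦ ⟨hu.2, hu.1.2⟩

/-- Gluing two strictly increasing functions at a point where they agree. [folklore] -/
theorem strictMonoOn_ite_Icc (hf : StrictMonoOn f (Icc a b)) (hg : StrictMonoOn g (Icc b c))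
    (hfg : f b = g b) : StrictMonoOn (fun u ↦ if u ≤ b then f u else g u) (Icc a c) := by
  intro u hu v hv huv
  by_cases hu' : u ≤ b <;> by_cases hv' : v ≤ b
  · simp only [hu', hv', if_true]
    exact hf ⟨hu.1, hu'⟩ ⟨hv.1, hv'⟩ huv
  · simp only [hu', hv', if_true, if_false]
    rw [not_le] at hv'
    calc f u ≤ f b := hf.monotoneOn ⟨hu.1, hu'⟩ ⟨hu.1.trans hu', le_rfl⟩ hu'
      _ = g b := hfg
      _ < g v := hg ⟨le_rfl, hv'.le.trans hv.2⟩ ⟨hv'.le, hv.2⟩ hv'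
  · exact absurd (huv.le.trans hv') hu'
  · simp only [hu', hv', if_false]
    rw [not_le] at hu' hv'
    exact hg ⟨hu'.le, hu.2⟩ ⟨hv'.le, hv.2⟩ huv

end Glue

/-! ### Sub-polylines of a closed polygon, and reversal of a polyline -/

section Polylines

open scoped unitInterval

/-- Decomposition of a point of `[0, n - 1]` (`n ≥ 2`) as `j + θ` with `j + 1 < n`, `θ ∈ [0, 1]`.
[folklore] -/
theorem exists_nat_add_mem_Icc {n : ℕ} (hn : 2 ≤ n) {x : ℝ} (hx : x ∈ Icc (0 : ℝ) ((n : ℝ) - 1)) :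
    ∃ (j : ℕ) (θ : ℝ), j + 1 < n ∧ θ ∈ Icc (0 : ℝ) 1 ∧ x = j + θ := by
  set j : ℕ := min ⌊x⌋₊ (n - 2) with hj
  have hjx : (j : ℝ) ≤ x := by
    have h1 : (j : ℝ) ≤ ⌊x⌋₊ := by exact_mod_cast min_le_left _ _
    exact h1.trans (Nat.floor_le hx.1)
  have hxj : x ≤ j + 1 := by
    rcases le_total ⌊x⌋₊ (n - 2) with h | h
    · have : j = ⌊x⌋₊ := min_eq_left h
      rw [this]
      exact (Nat.lt_floor_add_one x).le
    · have : j = n - 2 := min_eq_right h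
      rw [this]
      have : ((n - 2 : ℕ) : ℝ) = (n : ℝ) - 2 := by
        rw [Nat.cast_sub hn]; norm_num
      rw [this]
      linarith [hx.2]
  refine ⟨j, x - j, ?_, ⟨by linarith, by linarith⟩, by ring⟩
  have : j ≤ n - 2 := min_le_right _ _
  omega

/-- **The closed polygon on a block of consecutive vertices is the polyline of that block**:
if `l[i + j] = Q[j]` for `j < |Q|` and `i + |Q| ≤ |l|`, then for `s ∈ [0, 1]`,
`polygonLoop l ((i + (|Q| - 1) s)/|l|) = affineInterp Q ((|Q| - 1) s)` (`= pathCurve Q s`).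
[folklore] -/
theorem polygonLoop_block {l Q : List ℂ} {i : ℕ} (hQ : Q ≠ []) (hiQ : i + Q.length ≤ l.length)
    (hget : ∀ (j : ℕ) (hj : j < Q.length), l[i + j]'(by omega) = Q[j]) {s : ℝ}
    (hs : s ∈ Icc (0 : ℝ) 1) :
    polygonLoop l ((i + ((Q.length : ℝ) - 1) * s) / l.length) =
      affineInterp Q (((Q.length : ℝ) - 1) * s) := by
  have hQ1 : 1 ≤ Q.length := List.length_pos_iff.2 hQ
  rcases eq_or_lt_of_le hQ1 with h1 | h2
  · -- a single vertex
    have hlen : (Q.length : ℝ) - 1 = 0 := by rw [← h1]; simp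
    rw [hlen, zero_mul, add_zero, polygonLoop_vertex (by omega),
      show (0 : ℝ) = ((0 : ℕ) : ℝ) by simp, affineInterp_natCast Q 0 (by omega)]
    have := hget 0 (by omega)
    simpa using this
  · set x : ℝ := ((Q.length : ℝ) - 1) * s with hx
    have hx' : x ∈ Icc (0 : ℝ) ((Q.length : ℝ) - 1) := by
      have hpos : (0 : ℝ) ≤ (Q.length : ℝ) - 1 := by
        have : (1 : ℝ) ≤ Q.length := by exact_mod_cast hQ1
        linarith
      exact ⟨mul_nonneg hpos hs.1, by nlinarith [hs.2]⟩
    obtain ⟨j, θ, hj, hθ, hxj⟩ := exists_nat_add_mem_Icc (by omega) hx'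
    have hN : i + j < l.length := by omega
    rw [hxj, show ((i : ℝ) + (j + θ)) = ((i + j : ℕ) : ℝ) + θ by push_cast; ring,
      polygonLoop_apply_div hN hθ,
      affineInterp_eq_lineMap Q j hj ⟨by linarith [hθ.1], by linarith [hθ.2]⟩, add_sub_cancel_left]
    have e1 : l[i + j] = Q[j] := hget j (by omega)
    have e2 : l[(i + j + 1) % l.length]'(Nat.mod_lt _ (by omega)) = Q[j + 1] := by
      rw [getElem_congr_idx (Nat.mod_eq_of_lt (by omega))]
      exact hget (j + 1) hj
    rw [e1, e2]

/-- **Reversal of a polyline**: `affineInterp Q.reverse x = affineInterp Q (|Q| - 1 - x)` on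
`[0, |Q| - 1]`. [folklore] -/
theorem affineInterp_reverse {Q : List ℂ} (hQ : Q ≠ []) {x : ℝ}
    (hx : x ∈ Icc (0 : ℝ) ((Q.length : ℝ) - 1)) :
    affineInterp Q.reverse x = affineInterp Q (((Q.length : ℝ) - 1) - x) := by
  have hQ1 : 1 ≤ Q.length := List.length_pos_iff.2 hQ
  rcases eq_or_lt_of_le hQ1 with h1 | h2
  · obtain ⟨q, hq⟩ : ∃ q, Q = [q] := List.length_eq_one_iff.1 h1.symm
    subst hq
    simp
  · obtain ⟨j, θ, hj, hθ, hxj⟩ := exists_nat_add_mem_Icc (by omega) hx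
    set n := Q.length with hn
    have hrlen : Q.reverse.length = n := by simp [hn]
    have hj' : j + 1 < Q.reverse.length := by rw [hrlen]; exact hj
    rw [hxj, affineInterp_eq_lineMap Q.reverse j hj' ⟨by linarith [hθ.1], by linarith [hθ.2]⟩,
      add_sub_cancel_left]
    -- the right-hand side on the segment `[n - 2 - j, n - 1 - j]`
    have hk : (n - 2 - j) + 1 < Q.length := by omega
    have hy : ((n : ℝ) - 1) - ((j : ℝ) + θ) ∈ Icc (((n - 2 - j : ℕ) : ℝ)) ((n - 2 - j : ℕ) + 1) := by
      have : ((n - 2 - j : ℕ) : ℝ) = (n : ℝ) - 2 - j := by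
        rw [Nat.cast_sub (by omega), Nat.cast_sub (by omega)]; norm_num
      rw [this]
      constructor <;> linarith [hθ.1, hθ.2]
    rw [affineInterp_eq_lineMap Q (n - 2 - j) hk hy]
    have eθ : ((n : ℝ) - 1) - ((j : ℝ) + θ) - ((n - 2 - j : ℕ) : ℝ) = 1 - θ := by
      rw [Nat.cast_sub (by omega), Nat.cast_sub (by omega)]; push_cast; ring
    rw [eθ, AffineMap.lineMap_apply_one_sub]
    have e1 : Q.reverse[j] = Q[n - 2 - j + 1] := by
      rw [List.getElem_reverse]
      exact getElem_congr_idx (by omega)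
    have e2 : Q.reverse[j + 1] = Q[n - 2 - j] := by
      rw [List.getElem_reverse]
      exact getElem_congr_idx (by omega)
    rw [e1, e2]

namespace USTPeano

/-- Reversal of a polyline curve: `pathCurve Q.reverse t = pathCurve Q (1 - t)`. [folklore] -/
theorem pathCurve_reverse_apply {Q : List ℂ} (hQ : Q ≠ []) (t : I) :
    pathCurve Q.reverse t = pathCurve Q (σ t) := by
  rw [pathCurve_apply, pathCurve_apply, List.length_reverse, unitInterval.coe_symm_eq,
    affineInterp_reverse hQ]
  · congr 1; ring
  · have hpos : (0 : ℝ) ≤ (Q.length : ℝ) - 1 := by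
      have : (1 : ℝ) ≤ Q.length := by exact_mod_cast List.length_pos_iff.2 hQ
      linarith
    exact ⟨mul_nonneg hpos t.2.1, by nlinarith [t.2.2]⟩

/-- The reversed polyline curve is the polyline of the reversed list. [folklore] -/
theorem pathCurve_reverse {Q : List ℂ} (hQ : Q ≠ []) :
    (pathCurve Q).reverse = pathCurve Q.reverse := by
  ext t
  exact (pathCurve_reverse_apply hQ t).symm

/-- The polyline curve at parameter `s` is the interpolation at `(|Q| - 1) s`. [folklore] -/
theorem pathCurve_apply_mk (Q : List ℂ) {s : ℝ} (hs : s ∈ Icc (0 : ℝ) 1) :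
    pathCurve Q ⟨s, hs⟩ = affineInterp Q (((Q.length : ℝ) - 1) * s) := rfl

end USTPeano

end Polylines

/-! ### The matching map of one period -/

section MatchingMap

/-- **The matching map of one period.** Given marks `m₀ + κ < m₁ - κ`, `m₁ + κ < m₀ + 1 - κ`
(`κ > 0`), integers `k, m ≥ 2` and increasing homeomorphisms `FA`, `FB` of `[0, 1]` (extended
continuously to `ℝ`), there is a continuous strictly increasing `Θ₀ : [m₀, m₀ + 1] → [0, 1]`,
`Θ₀ m₀ = 0`, `Θ₀ (m₀ + 1) = 1`, which is affine from `0` to `1/N` on `[m₀, m₀ + κ]`, equal to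
`(1 + (k - 1) FA(·))/N` (after the affine change of variable onto `[0, 1]`) on `[m₀ + κ, m₁ - κ]`,
affine from `k/N` to `(k + 2)/N` on `[m₁ - κ, m₁ + κ]`, equal to `(k + 2 + (m - 1) FB(·))/N` on
`[m₁ + κ, m₀ + 1 - κ]` and affine from `(k + m + 1)/N` to `1` on `[m₀ + 1 - κ, m₀ + 1]`, where
`N = k + m + 2` (five continuous increasing pieces glued at matching values). [folklore] -/
theorem exists_matchingMap {m₀ m₁ κ : ℝ} {k m : ℕ} {FA FB : ℝ → ℝ}
    (hκ : 0 < κ) (hwinA : m₀ + κ < m₁ - κ) (hwinB : m₁ + κ < m₀ + 1 - κ)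
    (hk : 2 ≤ k) (hm : 2 ≤ m) (hFAc : Continuous FA) (hFBc : Continuous FB)
    (hFAm : StrictMonoOn FA (Icc 0 1)) (hFBm : StrictMonoOn FB (Icc 0 1))
    (hFA0 : FA 0 = 0) (hFA1 : FA 1 = 1) (hFB0 : FB 0 = 0) (hFB1 : FB 1 = 1) :
    ∃ Θ₀ : ℝ → ℝ, ContinuousOn Θ₀ (Icc m₀ (m₀ + 1)) ∧ StrictMonoOn Θ₀ (Icc m₀ (m₀ + 1)) ∧
      Θ₀ m₀ = 0 ∧ Θ₀ (m₀ + 1) = 1 ∧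
      (∀ u, u ≤ m₀ + κ → Θ₀ u = (u - m₀) / (κ * (k + m + 2))) ∧
      (∀ u, ¬u ≤ m₀ + κ → u ≤ m₁ - κ →
        Θ₀ u = (1 + ((k : ℝ) - 1) * FA ((u - m₀ - κ) / (m₁ - m₀ - 2 * κ))) / (k + m + 2)) ∧
      (∀ u, ¬u ≤ m₀ + κ → ¬u ≤ m₁ - κ → u ≤ m₁ + κ →
        Θ₀ u = (k + (u - (m₁ - κ)) / κ) / (k + m + 2)) ∧
      (∀ u, ¬u ≤ m₀ + κ → ¬u ≤ m₁ - κ → ¬u ≤ m₁ + κ → u ≤ m₀ + 1 - κ →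
        Θ₀ u = (k + 2 + ((m : ℝ) - 1) * FB ((u - m₁ - κ) / (m₀ + 1 - m₁ - 2 * κ))) /
          (k + m + 2)) ∧
      (∀ u, ¬u ≤ m₀ + κ → ¬u ≤ m₁ - κ → ¬u ≤ m₁ + κ → ¬u ≤ m₀ + 1 - κ →
        Θ₀ u = (k + m + 1 + (u - (m₀ + 1 - κ)) / κ) / (k + m + 2)) := by
  set N : ℝ := k + m + 2 with hN
  have hNpos : 0 < N := by rw [hN]; positivity
  have hNne : N ≠ 0 := hNpos.ne'
  -- the five pieces
  set F1 : ℝ → ℝ := fun u ↦ (u - m₀) / (κ * N) with hF1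
  set F2 : ℝ → ℝ := fun u ↦ (1 + ((k : ℝ) - 1) * FA ((u - m₀ - κ) / (m₁ - m₀ - 2 * κ))) / N
    with hF2
  set F3 : ℝ → ℝ := fun u ↦ (k + (u - (m₁ - κ)) / κ) / N with hF3
  set F4 : ℝ → ℝ := fun u ↦
    (k + 2 + ((m : ℝ) - 1) * FB ((u - m₁ - κ) / (m₀ + 1 - m₁ - 2 * κ))) / N with hF4
  set F5 : ℝ → ℝ := fun u ↦ (k + m + 1 + (u - (m₀ + 1 - κ)) / κ) / N with hF5
  set G4 : ℝ → ℝ := fun u ↦ if u ≤ m₀ + 1 - κ then F4 u else F5 u with hG4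
  set G3 : ℝ → ℝ := fun u ↦ if u ≤ m₁ + κ then F3 u else G4 u with hG3
  set G2 : ℝ → ℝ := fun u ↦ if u ≤ m₁ - κ then F2 u else G3 u with hG2
  set T : ℝ → ℝ := fun u ↦ if u ≤ m₀ + κ then F1 u else G2 u with hT
  -- values at the junctions
  have hκne : κ ≠ 0 := hκ.ne'
  have hwA : m₁ - m₀ - 2 * κ ≠ 0 := by linarith
  have hwB : m₀ + 1 - m₁ - 2 * κ ≠ 0 := by linarith
  have F1r : F1 (m₀ + κ) = 1 / N := by
    simp only [hF1]; field_simp; ring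
  have F2l : F2 (m₀ + κ) = 1 / N := by
    simp only [hF2]
    rw [show m₀ + κ - m₀ - κ = 0 by ring, zero_div, hFA0]; ring
  have F2r : F2 (m₁ - κ) = k / N := by
    simp only [hF2]
    rw [show m₁ - κ - m₀ - κ = m₁ - m₀ - 2 * κ by ring, div_self hwA, hFA1]; ring
  have F3l : F3 (m₁ - κ) = k / N := by simp only [hF3]; simp
  have F3r : F3 (m₁ + κ) = (k + 2) / N := by
    simp only [hF3]
    rw [show m₁ + κ - (m₁ - κ) = 2 * κ by ring, mul_div_cancel_right₀ _ hκne]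
  have F4l : F4 (m₁ + κ) = (k + 2) / N := by
    simp only [hF4]
    rw [show m₁ + κ - m₁ - κ = 0 by ring, zero_div, hFB0]; ring
  have F4r : F4 (m₀ + 1 - κ) = (k + m + 1) / N := by
    simp only [hF4]
    rw [show m₀ + 1 - κ - m₁ - κ = m₀ + 1 - m₁ - 2 * κ by ring, div_self hwB, hFB1]; ring
  have F5l : F5 (m₀ + 1 - κ) = (k + m + 1) / N := by simp only [hF5]; simp
  have F5r : F5 (m₀ + 1) = 1 := by
    simp only [hF5]
    rw [show m₀ + 1 - (m₀ + 1 - κ) = κ by ring, div_self hκne, hN]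
    field_simp; ring
  have G4l : G4 (m₁ + κ) = (k + 2) / N := by
    simp only [hG4]; rw [if_pos (by linarith)]; exact F4l
  have G3l : G3 (m₁ - κ) = k / N := by
    simp only [hG3]; rw [if_pos (by linarith)]; exact F3l
  have G2l : G2 (m₀ + κ) = 1 / N := by
    simp only [hG2]; rw [if_pos (by linarith)]; exact F2l
  -- continuity
  have cF1 : Continuous F1 := by simp only [hF1]; fun_prop
  have cF2 : Continuous F2 := by simp only [hF2]; fun_prop
  have cF3 : Continuous F3 := by simp only [hF3]; fun_prop
  have cF4 : Continuous F4 := by simp only [hF4]; fun_prop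
  have cF5 : Continuous F5 := by simp only [hF5]; fun_prop
  have cG4 : ContinuousOn G4 (Icc (m₁ + κ) (m₀ + 1)) :=
    continuousOn_ite_Icc cF4.continuousOn cF5.continuousOn (by rw [F4r, F5l])
  have cG3 : ContinuousOn G3 (Icc (m₁ - κ) (m₀ + 1)) :=
    continuousOn_ite_Icc cF3.continuousOn cG4 (by rw [F3r, G4l])
  have cG2 : ContinuousOn G2 (Icc (m₀ + κ) (m₀ + 1)) :=
    continuousOn_ite_Icc cF2.continuousOn cG3 (by rw [F2r, G3l])
  have cT : ContinuousOn T (Icc m₀ (m₀ + 1)) :=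
    continuousOn_ite_Icc cF1.continuousOn cG2 (by rw [F1r, G2l])
  -- monotonicity
  have hk' : (0 : ℝ) < (k : ℝ) - 1 := by
    have : (2 : ℝ) ≤ k := by exact_mod_cast hk
    linarith
  have hm' : (0 : ℝ) < (m : ℝ) - 1 := by
    have : (2 : ℝ) ≤ m := by exact_mod_cast hm
    linarith
  have mF1 : StrictMono F1 := fun u v huv ↦ by
    simp only [hF1]
    exact div_lt_div_of_pos_right (by linarith) (by positivity)
  have mF2 : StrictMonoOn F2 (Icc (m₀ + κ) (m₁ - κ)) := by
    intro u hu v hv huv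
    simp only [hF2]
    have hw : 0 < m₁ - m₀ - 2 * κ := by linarith
    refine div_lt_div_of_pos_right ?_ hNpos
    have hmu : (u - m₀ - κ) / (m₁ - m₀ - 2 * κ) ∈ Icc (0 : ℝ) 1 :=
      ⟨div_nonneg (by linarith [hu.1]) hw.le, by rw [div_le_one hw]; linarith [hu.2]⟩
    have hmv : (v - m₀ - κ) / (m₁ - m₀ - 2 * κ) ∈ Icc (0 : ℝ) 1 :=
      ⟨div_nonneg (by linarith [hv.1]) hw.le, by rw [div_le_one hw]; linarith [hv.2]⟩
    have hlt : (u - m₀ - κ) / (m₁ - m₀ - 2 * κ) < (v - m₀ - κ) / (m₁ - m₀ - 2 * κ) :=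
      div_lt_div_of_pos_right (by linarith) hw
    have := mul_lt_mul_of_pos_left (hFAm hmu hmv hlt) hk'
    linarith
  have mF3 : StrictMono F3 := fun u v huv ↦ by
    simp only [hF3]
    refine div_lt_div_of_pos_right ?_ hNpos
    have := div_lt_div_of_pos_right (show u - (m₁ - κ) < v - (m₁ - κ) by linarith) hκ
    linarith
  have mF4 : StrictMonoOn F4 (Icc (m₁ + κ) (m₀ + 1 - κ)) := by
    intro u hu v hv huv
    simp only [hF4]
    have hw : 0 < m₀ + 1 - m₁ - 2 * κ := by linarith
    refine div_lt_div_of_pos_right ?_ hNpos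
    have hmu : (u - m₁ - κ) / (m₀ + 1 - m₁ - 2 * κ) ∈ Icc (0 : ℝ) 1 :=
      ⟨div_nonneg (by linarith [hu.1]) hw.le, by rw [div_le_one hw]; linarith [hu.2]⟩
    have hmv : (v - m₁ - κ) / (m₀ + 1 - m₁ - 2 * κ) ∈ Icc (0 : ℝ) 1 :=
      ⟨div_nonneg (by linarith [hv.1]) hw.le, by rw [div_le_one hw]; linarith [hv.2]⟩
    have hlt : (u - m₁ - κ) / (m₀ + 1 - m₁ - 2 * κ) < (v - m₁ - κ) / (m₀ + 1 - m₁ - 2 * κ) :=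
      div_lt_div_of_pos_right (by linarith) hw
    have := mul_lt_mul_of_pos_left (hFBm hmu hmv hlt) hm'
    linarith
  have mF5 : StrictMono F5 := fun u v huv ↦ by
    simp only [hF5]
    refine div_lt_div_of_pos_right ?_ hNpos
    have := div_lt_div_of_pos_right (show u - (m₀ + 1 - κ) < v - (m₀ + 1 - κ) by linarith) hκ
    linarith
  have mG4 : StrictMonoOn G4 (Icc (m₁ + κ) (m₀ + 1)) :=
    strictMonoOn_ite_Icc mF4 (mF5.strictMonoOn _) (by rw [F4r, F5l])
  have mG3 : StrictMonoOn G3 (Icc (m₁ - κ) (m₀ + 1)) :=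
    strictMonoOn_ite_Icc (mF3.strictMonoOn _) mG4 (by rw [F3r, G4l])
  have mG2 : StrictMonoOn G2 (Icc (m₀ + κ) (m₀ + 1)) :=
    strictMonoOn_ite_Icc mF2 mG3 (by rw [F2r, G3l])
  have mT : StrictMonoOn T (Icc m₀ (m₀ + 1)) :=
    strictMonoOn_ite_Icc (mF1.strictMonoOn _) mG2 (by rw [F1r, G2l])
  -- endpoint values and branches
  refine ⟨T, cT, mT, ?_, ?_, ?_, ?_, ?_, ?_, ?_⟩
  · simp only [hT, hF1]; rw [if_pos (by linarith)]; simp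
  · simp only [hT, hG2, hG3, hG4]
    rw [if_neg (by linarith), if_neg (by linarith), if_neg (by linarith), if_neg (by linarith)]
    exact F5r
  · intro u h1
    simp only [hT]; rw [if_pos h1]
  · intro u h1 h2
    simp only [hT, hG2]; rw [if_neg h1, if_pos h2]
  · intro u h1 h2 h3
    simp only [hT, hG2, hG3]; rw [if_neg h1, if_neg h2, if_pos h3]
  · intro u h1 h2 h3 h4
    simp only [hT, hG2, hG3, hG4]; rw [if_neg h1, if_neg h2, if_neg h3, if_pos h4]
  · intro u h1 h2 h3 h4
    simp only [hT, hG2, hG3, hG4]; rw [if_neg h1, if_neg h2, if_neg h3, if_neg h4]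

end MatchingMap

/-! ### The matched loop of an approximation -/

namespace USTPeano

open scoped unitInterval

/-- A reparametrisation realising a strict bound on the reparametrisation distance. [folklore] -/
theorem exists_orderIso_of_reparamDist_lt {γ₁ γ₂ : Curve ℂ} {C : ℝ}
    (h : Curve.reparamDist γ₁ γ₂ < C) : ∃ φ : I ≃o I, ∀ s : I, dist (γ₁ s) (γ₂ (φ s)) < C := by
  obtain ⟨φ, hφ⟩ := exists_lt_of_ciInf_lt h
  refine ⟨φ, fun s ↦ lt_of_le_of_lt ?_ hφ⟩
  have := ContinuousMap.dist_apply_le_dist (f := γ₁.toContinuousMap)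
    (g := (γ₂.reparam φ).toContinuousMap) s
  simpa using this

/-- `dist (c x) (c y) = |c| dist x y` for a real factor. [folklore] -/
theorem dist_ofReal_mul (c : ℝ) (x y : ℂ) : dist ((c : ℂ) * x) ((c : ℂ) * y) = |c| * dist x y := by
  rw [dist_eq_norm, dist_eq_norm, ← mul_sub, norm_mul, Complex.norm_real, Real.norm_eq_abs]

/-- A point of a segment whose endpoints are within `1` of `p` is within `1` of `p`. [folklore] -/
theorem dist_lineMap_le_one {x y p : ℂ} (hx : dist x p ≤ 1) (hy : dist y p ≤ 1) {τ : ℝ}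
    (hτ : τ ∈ Icc (0 : ℝ) 1) : dist (AffineMap.lineMap x y τ) p ≤ 1 := by
  have := (convex_closedBall p 1).lineMap_mem (mem_closedBall.2 hx) (mem_closedBall.2 hy) hτ
  exact mem_closedBall.1 this

namespace Domain

variable (Δ : Domain)

/-- The `α`-block of the boundary cycle: vertices `1, …, |α|`. [folklore] -/
theorem boundaryVerts_getElem_one_add {j : ℕ} (hj : j < (Δ.α.map primalPt).length) :
    (boundaryVerts Δ.α Δ.β Δ.a Δ.b)[1 + j]'(by simp at hj ⊢; omega) = (Δ.α.map primalPt)[j] := by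
  have hj' : j < Δ.α.length := by simpa using hj
  rw [getElem_congr_idx (add_comm 1 j), boundaryVerts_getElem_succ Δ.a Δ.b hj']
  simp

/-- The reversed-`β`-block of the boundary cycle: vertices `|α| + 2, …, |α| + |β| + 1`. [folklore] -/
theorem boundaryVerts_getElem_add_two_add {j : ℕ} (hj : j < (Δ.β.map dualPt).reverse.length) :
    (boundaryVerts Δ.α Δ.β Δ.a Δ.b)[Δ.α.length + 2 + j]'(by simp at hj ⊢; omega) =
      (Δ.β.map dualPt).reverse[j] := by
  have hj' : j < Δ.β.length := by simpa using hj
  rw [getElem_congr_idx (show Δ.α.length + 2 + j = Δ.α.length + Δ.β.length + 1 - (Δ.β.length - 1 - j)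
    by omega), boundaryVerts_getElem_β Δ.a Δ.b (by omega), List.getElem_reverse]
  simp only [List.length_map, List.getElem_map]

/-- Vertex `|α|` is `α_b`, within `1` of `b`. [folklore] -/
theorem dist_boundaryVerts_length_α_le :
    dist ((boundaryVerts Δ.α Δ.β Δ.a Δ.b)[Δ.α.length]'(by simp only [length_boundaryVerts]; omega))
      (peanoPt Δ.b) ≤ 1 := by
  have hk : 1 ≤ Δ.α.length := List.length_pos_iff.2 Δ.α_ne_nil
  rw [getElem_congr_idx (show Δ.α.length = (Δ.α.length - 1) + 1 by omega),
    boundaryVerts_getElem_succ Δ.a Δ.b (by omega), ← List.getLast_eq_getElem Δ.α_ne_nil,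
    Δ.getLast_α, dist_comm, dist_eq_norm]
  exact norm_peanoPt_sub_primalPt_le _

/-- Vertex `1` is `α_a`, within `1` of `a`. [folklore] -/
theorem dist_boundaryVerts_one_le :
    dist ((boundaryVerts Δ.α Δ.β Δ.a Δ.b)[1]'(by simp)) (peanoPt Δ.a) ≤ 1 := by
  rw [boundaryVerts_one Δ.a Δ.b Δ.α_ne_nil, Δ.head_α, dist_comm, dist_eq_norm]
  exact norm_peanoPt_sub_primalPt_le _

/-- Vertex `|α| + 2` is `β_b`, within `1` of `b`. [folklore] -/
theorem dist_boundaryVerts_length_α_add_two_le :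
    dist ((boundaryVerts Δ.α Δ.β Δ.a Δ.b)[Δ.α.length + 2]'(by simp; exact List.length_pos_iff.2 Δ.β_ne_nil))
      (peanoPt Δ.b) ≤ 1 := by
  have hm : 1 ≤ Δ.β.length := List.length_pos_iff.2 Δ.β_ne_nil
  rw [getElem_congr_idx (show Δ.α.length + 2 = Δ.α.length + Δ.β.length + 1 - (Δ.β.length - 1)
    by omega), boundaryVerts_getElem_β Δ.a Δ.b (by omega), ← List.getLast_eq_getElem Δ.β_ne_nil,
    Δ.getLast_β, dist_comm, dist_eq_norm]
  exact norm_peanoPt_sub_dualPt_le _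

/-- The last vertex `|α| + |β| + 1` is `β_a`, within `1` of `a`. [folklore] -/
theorem dist_boundaryVerts_last_le :
    dist ((boundaryVerts Δ.α Δ.β Δ.a Δ.b)[Δ.α.length + Δ.β.length + 1]'(by simp))
      (peanoPt Δ.a) ≤ 1 := by
  have hm : 1 ≤ Δ.β.length := List.length_pos_iff.2 Δ.β_ne_nil
  rw [getElem_congr_idx (show Δ.α.length + Δ.β.length + 1 = Δ.α.length + Δ.β.length + 1 - 0
    by omega), boundaryVerts_getElem_β Δ.a Δ.b (by omega), ← List.head_eq_getElem Δ.β_ne_nil,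
    Δ.head_β, dist_comm, dist_eq_norm]
  exact norm_peanoPt_sub_dualPt_le _

end Domain

/-- The first point of a polyline curve. [folklore] -/
theorem pathCurve_zero' {Q : List ℂ} (hQ : Q ≠ []) :
    pathCurve Q 0 = Q[0]'(List.length_pos_iff.2 hQ) := by
  rw [show (0 : I) = ⟨0, left_mem_Icc.2 zero_le_one⟩ from rfl, pathCurve_apply_mk, mul_zero,
    show (0 : ℝ) = ((0 : ℕ) : ℝ) by simp, affineInterp_natCast Q 0]

/-- The last point of a polyline curve. [folklore] -/
theorem pathCurve_one' {Q : List ℂ} (hQ : Q ≠ []) :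
    pathCurve Q 1 = Q[Q.length - 1]'(by have := List.length_pos_iff.2 hQ; omega) := by
  have h1 : 1 ≤ Q.length := List.length_pos_iff.2 hQ
  rw [show (1 : I) = ⟨1, right_mem_Icc.2 zero_le_one⟩ from rfl, pathCurve_apply_mk, mul_one,
    show (Q.length : ℝ) - 1 = ((Q.length - 1 : ℕ) : ℝ) by rw [Nat.cast_sub h1, Nat.cast_one],
    affineInterp_natCast Q (Q.length - 1)]

section MainEstimate

variable {D : SmoothDomain} {R : ℝ} {Δ : Domain}

/-- The reparametrisation of `α`: `|α(s) - R α_D(φ_A s)| < 11`. [folklore] -/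
theorem IsApproximation.exists_orderIso_α (h : IsApproximation D R Δ) :
    ∃ φ : I ≃o I, ∀ s : I, dist (pathCurve (Δ.α.map primalPt) s) (R * D.arcA (φ s)) < 11 := by
  obtain ⟨φ, hφ⟩ := exists_orderIso_of_reparamDist_lt (lt_of_le_of_lt h.1 (by norm_num : (10:ℝ) < 11))
  exact ⟨φ, fun s ↦ by simpa using hφ s⟩

/-- The reparametrisation of `β`, reversed: `|β⁻(s) - R β_D⁻(φ_B s)| < 11`. [folklore] -/
theorem IsApproximation.exists_orderIso_β (h : IsApproximation D R Δ) :
    ∃ φ : I ≃o I, ∀ s : I,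
      dist (pathCurve (Δ.β.map dualPt).reverse s) (R * D.arcB (σ (φ s))) < 11 := by
  have hne : Δ.β.map dualPt ≠ [] := by simpa using Δ.β_ne_nil
  have h1 : Curve.reparamDist (pathCurve (Δ.β.map dualPt).reverse) (scaleCurve R D.arcB).reverse < 11 := by
    rw [← pathCurve_reverse hne]
    exact lt_of_le_of_lt ((Curve.reparamDist_reverse_le _ _).trans h.2.1) (by norm_num)
  obtain ⟨φ, hφ⟩ := exists_orderIso_of_reparamDist_lt h1
  exact ⟨φ, fun s ↦ by simpa using hφ s⟩

/-- **`a^R` is within `12` of `R a`.** [cite: LawlerSchrammWerner2004, §4.3] -/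
theorem IsApproximation.dist_peanoPt_a_le (h : IsApproximation D R Δ) :
    dist (peanoPt Δ.a) (R * D.toMarkedDomain.pt 0) ≤ 12 := by
  obtain ⟨φ, hφ⟩ := h.exists_orderIso_α
  have hne : Δ.α.map primalPt ≠ [] := by simpa using Δ.α_ne_nil
  have h0 := hφ 0
  rw [show (0 : I) = ⊥ from rfl, φ.map_bot, show (⊥ : I) = 0 from rfl, D.arcA_zero,
    pathCurve_zero' hne] at h0
  have h1 : dist (peanoPt Δ.a) ((Δ.α.map primalPt)[0]'(List.length_pos_iff.2 hne)) ≤ 1 := by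
    have := Δ.dist_boundaryVerts_one_le
    rw [boundaryVerts_one Δ.a Δ.b Δ.α_ne_nil] at this
    rw [dist_comm]
    simpa [List.getElem_map, List.head_eq_getElem] using this
  linarith [dist_triangle (peanoPt Δ.a) ((Δ.α.map primalPt)[0]'(List.length_pos_iff.2 hne))
    (R * D.toMarkedDomain.pt 0)]

/-- **`b^R` is within `12` of `R b`.** [cite: LawlerSchrammWerner2004, §4.3] -/
theorem IsApproximation.dist_peanoPt_b_le (h : IsApproximation D R Δ) :
    dist (peanoPt Δ.b) (R * D.toMarkedDomain.pt 1) ≤ 12 := by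
  obtain ⟨φ, hφ⟩ := h.exists_orderIso_α
  have hne : Δ.α.map primalPt ≠ [] := by simpa using Δ.α_ne_nil
  have h0 := hφ 1
  rw [show (1 : I) = ⊤ from rfl, φ.map_top, show (⊤ : I) = 1 from rfl, D.arcA_one,
    pathCurve_one' hne] at h0
  have h1 : dist (peanoPt Δ.b) ((Δ.α.map primalPt)[(Δ.α.map primalPt).length - 1]'(by
      have := List.length_pos_iff.2 hne; omega)) ≤ 1 := by
    have := Δ.dist_boundaryVerts_length_α_le
    have hk : 1 ≤ Δ.α.length := List.length_pos_iff.2 Δ.α_ne_nil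
    rw [getElem_congr_idx (show Δ.α.length = 1 + (Δ.α.length - 1) by omega),
      Δ.boundaryVerts_getElem_one_add (by simp; omega)] at this
    rw [dist_comm]
    simpa using this
  linarith [dist_triangle (peanoPt Δ.b) ((Δ.α.map primalPt)[(Δ.α.map primalPt).length - 1]'(by
      have := List.length_pos_iff.2 hne; omega)) (R * D.toMarkedDomain.pt 1)]

end MainEstimate

end USTPeano

namespace USTPeano

open scoped unitInterval

section MatchedLoop

variable {D : SmoothDomain} {R : ℝ} {Δ : Domain}

/-- **A Jordan-domain structure on `R⁻¹ D^R` whose boundary loop is uniformly `14/R`-close to the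
boundary loop of `D`.** For an approximation `D^R = D(α^R, β^R, a^R, b^R)` of `(RD, Rα_D, Rβ_D)`
([LSW04] §4.3: `ρ(α^R, Rα_D) ≤ 10`, `ρ(β^R, Rβ_D) ≤ 10`, `ρ` the reparametrisation distance) at a
scale `R` with `R |a - b| > 22`, the boundary polygon of `D^R`, traversed `a^R → α^R → b^R → β^R⁻ → a^R`
and reparametrised through the two reparametrisations realising `ρ ≤ 10` (with short windows at the
junctions `a^R`, `b^R`), stays within `14` of `R` times the boundary loop of `D` at every time; so
`R⁻¹ D^R` with this loop is a Jordan domain whose boundary parametrisation is uniformly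
`14/R`-close to that of `D` — the hypothesis of Radó's theorem (`JordanDomain.rado_tendstoUniformlyOn`).
[cite: LawlerSchrammWerner2004, §4.3] -/
theorem IsApproximation.exists_jordanDomain (h : IsApproximation D R Δ)
    (hR : 22 < R * dist (D.toMarkedDomain.pt 0) (D.toMarkedDomain.pt 1)) :
    ∃ E : JordanDomain, E.carrier = (fun z : ℂ ↦ ((R⁻¹ : ℝ) : ℂ) * z) '' Δ.carrier ∧
      ∀ t, dist (E.boundary t) (D.toMarkedDomain.boundary t) ≤ 14 / R := by
  classical
  -- positivity of `R`
  have hab : 0 < dist (D.toMarkedDomain.pt 0) (D.toMarkedDomain.pt 1) :=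
    dist_pos.2 fun heq ↦ by simpa using D.toMarkedDomain.pt_injective heq
  have hRpos : 0 < R := by
    by_contra hle
    have := mul_nonpos_of_nonpos_of_nonneg (not_lt.1 hle) hab.le
    linarith
  -- the marks and the boundary loop of `D`
  set bd := D.toMarkedDomain.boundary with hbd
  set m₀ := D.toMarkedDomain.mark 0 with hm₀
  set m₁ := D.toMarkedDomain.mark 1 with hm₁
  have hm01 : m₀ < m₁ := D.toMarkedDomain.strictMono_mark (show (0 : Fin 2) < 1 by decide)
  have hm₀0 : 0 ≤ m₀ := (D.toMarkedDomain.mark_mem 0).1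
  have hm₁1 : m₁ < 1 := (D.toMarkedDomain.mark_mem 1).2
  have hpt0 : D.toMarkedDomain.pt 0 = bd m₀ := rfl
  have hpt1 : D.toMarkedDomain.pt 1 = bd m₁ := rfl
  rw [hpt0, hpt1] at hab hR
  have harcA : ∀ t : I, D.arcA t = bd (m₀ + (t : ℝ) * (m₁ - m₀)) := fun t ↦ D.arcA_apply t
  have harcB : ∀ t : I, D.arcB (σ t) = bd (m₁ + (t : ℝ) * (m₀ + 1 - m₁)) := fun t ↦ by
    rw [D.arcB_apply, unitInterval.coe_symm_eq]
    congr 1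
    ring
  have hbd1 : bd (m₀ + 1) = bd m₀ := D.toMarkedDomain.periodic_boundary m₀
  -- the lists
  set αpts := Δ.α.map primalPt with hαpts
  set βr := (Δ.β.map dualPt).reverse with hβr
  set verts := boundaryVerts Δ.α Δ.β Δ.a Δ.b with hverts
  set k := Δ.α.length with hk
  set m := Δ.β.length with hm
  have hαne : αpts ≠ [] := by simp [hαpts, Δ.α_ne_nil]
  have hβne : βr ≠ [] := by simp [hβr, Δ.β_ne_nil]
  have hαlen : αpts.length = k := by simp [hαpts, hk]
  have hβlen : βr.length = m := by simp [hβr, hm]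
  have hN : verts.length = k + m + 2 := by simp [hverts, hk, hm]
  have hNr : (verts.length : ℝ) = k + m + 2 := by rw [hN]; push_cast; ring
  have hk1 : 1 ≤ k := by rw [hk]; exact List.length_pos_iff.2 Δ.α_ne_nil
  have hm1 : 1 ≤ m := by rw [hm]; exact List.length_pos_iff.2 Δ.β_ne_nil
  -- the reparametrisations and the endpoint estimates
  obtain ⟨φA, hφA⟩ := h.exists_orderIso_α
  obtain ⟨φB, hφB⟩ := h.exists_orderIso_β
  have hA0 : dist (αpts[0]'(by omega)) (R * bd m₀) < 11 := by
    have := hφA 0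
    rwa [show (0 : I) = ⊥ from rfl, φA.map_bot, show (⊥ : I) = 0 from rfl, D.arcA_zero, hpt0,
      pathCurve_zero' hαne] at this
  have hA1 : dist (αpts[k - 1]'(by omega)) (R * bd m₁) < 11 := by
    have := hφA 1
    rw [show (1 : I) = ⊤ from rfl, φA.map_top, show (⊤ : I) = 1 from rfl, D.arcA_one, hpt1,
      pathCurve_one' hαne] at this
    rwa [getElem_congr_idx (show αpts.length - 1 = k - 1 by rw [hαlen])] at this
  have hB0 : dist (βr[0]'(by omega)) (R * bd m₁) < 11 := by
    have := hφB 0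
    rwa [show (0 : I) = ⊥ from rfl, φB.map_bot, show (⊥ : I) = 0 from rfl, unitInterval.symm_zero,
      D.arcB_one, hpt1, pathCurve_zero' hβne] at this
  have hB1 : dist (βr[m - 1]'(by omega)) (R * bd m₀) < 11 := by
    have := hφB 1
    rw [show (1 : I) = ⊤ from rfl, φB.map_top, show (⊤ : I) = 1 from rfl, unitInterval.symm_one,
      D.arcB_zero, hpt0, pathCurve_one' hβne] at this
    rwa [getElem_congr_idx (show βr.length - 1 = m - 1 by rw [hβlen])] at this
  -- `|α| ≥ 2`, `|β| ≥ 2`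
  have hk2 : 2 ≤ k := by
    by_contra hlt
    have e : αpts[k - 1]'(by omega) = αpts[0]'(by omega) := getElem_congr_idx (by omega)
    rw [e] at hA1
    have : dist ((R : ℂ) * bd m₀) (R * bd m₁) < 22 := by
      linarith [dist_triangle_left ((R : ℂ) * bd m₀) ((R : ℂ) * bd m₁) (αpts[0]'(by omega))]
    rw [dist_ofReal_mul, abs_of_pos hRpos] at this
    linarith
  have hm2 : 2 ≤ m := by
    by_contra hlt
    have e : βr[m - 1]'(by omega) = βr[0]'(by omega) := getElem_congr_idx (by omega)
    rw [e] at hB1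
    have : dist ((R : ℂ) * bd m₀) (R * bd m₁) < 22 := by
      linarith [dist_triangle_left ((R : ℂ) * bd m₀) ((R : ℂ) * bd m₁) (βr[0]'(by omega))]
    rw [dist_ofReal_mul, abs_of_pos hRpos] at this
    linarith
  -- the junction half-width `κ`
  obtain ⟨θ, hθ, hθ'⟩ := D.toMarkedDomain.toJordanDomain.exists_dist_boundary_lt (one_div_pos.2 hRpos)
  set κ := min (θ / 2) (min ((m₁ - m₀) / 4) ((m₀ + 1 - m₁) / 4)) with hκ
  have hκpos : 0 < κ := lt_min (by linarith) (lt_min (by linarith) (by linarith))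
  have hκθ : κ < θ := (min_le_left (θ / 2) _).trans_lt (by linarith)
  have hκA : 4 * κ ≤ m₁ - m₀ := by
    have : κ ≤ (m₁ - m₀) / 4 :=
      (min_le_right (θ / 2) _).trans (min_le_left ((m₁ - m₀) / 4) ((m₀ + 1 - m₁) / 4))
    linarith
  have hκB : 4 * κ ≤ m₀ + 1 - m₁ := by
    have : κ ≤ (m₀ + 1 - m₁) / 4 :=
      (min_le_right (θ / 2) _).trans (min_le_right ((m₁ - m₀) / 4) ((m₀ + 1 - m₁) / 4))
    linarith
  have hwin : ∀ s s', |s - s'| ≤ κ → dist ((R : ℂ) * bd s) ((R : ℂ) * bd s') ≤ 1 := by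
    intro s s' hss'
    rw [dist_ofReal_mul, abs_of_pos hRpos]
    have h1 := hθ' s s' (lt_of_le_of_lt hss' hκθ)
    rw [lt_div_iff₀ hRpos] at h1
    linarith [mul_comm R (dist (bd s) (bd s'))]
  -- the inverse reparametrisations
  set FA : ℝ → ℝ := fun x ↦ ((φA.symm (Set.projIcc 0 1 zero_le_one x) : I) : ℝ) with hFA
  set FB : ℝ → ℝ := fun x ↦ ((φB.symm (Set.projIcc 0 1 zero_le_one x) : I) : ℝ) with hFB
  have hFAc : Continuous FA :=
    continuous_subtype_val.comp (φA.symm.continuous.comp continuous_projIcc)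
  have hFBc : Continuous FB :=
    continuous_subtype_val.comp (φB.symm.continuous.comp continuous_projIcc)
  have hFAm : StrictMonoOn FA (Icc 0 1) := by
    intro x hx y hy hxy
    simp only [hFA, Set.projIcc_of_mem _ hx, Set.projIcc_of_mem _ hy]
    exact Subtype.coe_lt_coe.2 (φA.symm.strictMono (Subtype.mk_lt_mk.2 hxy))
  have hFBm : StrictMonoOn FB (Icc 0 1) := by
    intro x hx y hy hxy
    simp only [hFB, Set.projIcc_of_mem _ hx, Set.projIcc_of_mem _ hy]
    exact Subtype.coe_lt_coe.2 (φB.symm.strictMono (Subtype.mk_lt_mk.2 hxy))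
  have hFA0 : FA 0 = 0 := by
    simp only [hFA, Set.projIcc_left]
    rw [show (⟨0, left_mem_Icc.2 zero_le_one⟩ : I) = ⊥ from rfl, φA.symm.map_bot]; rfl
  have hFA1 : FA 1 = 1 := by
    simp only [hFA, Set.projIcc_right]
    rw [show (⟨1, right_mem_Icc.2 zero_le_one⟩ : I) = ⊤ from rfl, φA.symm.map_top]; rfl
  have hFB0 : FB 0 = 0 := by
    simp only [hFB, Set.projIcc_left]
    rw [show (⟨0, left_mem_Icc.2 zero_le_one⟩ : I) = ⊥ from rfl, φB.symm.map_bot]; rfl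
  have hFB1 : FB 1 = 1 := by
    simp only [hFB, Set.projIcc_right]
    rw [show (⟨1, right_mem_Icc.2 zero_le_one⟩ : I) = ⊤ from rfl, φB.symm.map_top]; rfl
  -- the matching map of one period and its periodic extension
  obtain ⟨Θ₀, hΘ₀c, hΘ₀m, hΘ₀0, hΘ₀1, hP1, hP2, hP3, hP4, hP5⟩ :=
    exists_matchingMap (m₀ := m₀) (m₁ := m₁) (k := k) (m := m) hκpos (by linarith) (by linarith)
      hk2 hm2 hFAc hFBc hFAm hFBm hFA0 hFA1 hFB0 hFB1
  set Θ : ℝ → ℝ := fun u ↦ (⌊u - m₀⌋ : ℝ) + Θ₀ (m₀ + Int.fract (u - m₀)) with hΘ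
  have hΘc : Continuous Θ := continuous_floor_add_comp_fract hΘ₀c hΘ₀0 hΘ₀1
  have hΘm : StrictMono Θ := strictMono_floor_add_comp_fract hΘ₀m hΘ₀0 hΘ₀1
  have hΘ1 : ∀ t, Θ (t + 1) = Θ t + 1 := fun t ↦ floor_add_comp_fract_add_one t
  have hΘs : Surjective Θ := surjective_floor_add_comp_fract hΘ₀c hΘ₀0 hΘ₀1
  -- ### the main estimate on one period
  have hmain : ∀ u ∈ Icc m₀ (m₀ + 1),
      dist (polygonLoop verts (Θ₀ u)) (R * bd u) ≤ 14 := by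
    intro u hu
    have hNpos : 0 < verts.length := by rw [hN]; omega
    -- vertices near `a` and `b`
    have hv0 : verts[0]'hNpos = peanoPt Δ.a := boundaryVerts_zero _ _ _ _
    have hv1 : dist (verts[1]'(by rw [hN]; omega)) (peanoPt Δ.a) ≤ 1 := Δ.dist_boundaryVerts_one_le
    have hvk : dist (verts[k]'(by rw [hN]; omega)) (peanoPt Δ.b) ≤ 1 :=
      Δ.dist_boundaryVerts_length_α_le
    have hvk1 : verts[k + 1]'(by rw [hN]; omega) = peanoPt Δ.b := boundaryVerts_length_succ _ _ _ _
    have hvk2 : dist (verts[k + 2]'(by rw [hN]; omega)) (peanoPt Δ.b) ≤ 1 :=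
      Δ.dist_boundaryVerts_length_α_add_two_le
    have hvN1 : dist (verts[k + m + 1]'(by rw [hN]; omega)) (peanoPt Δ.a) ≤ 1 :=
      Δ.dist_boundaryVerts_last_le
    have hpa : dist (peanoPt Δ.a) (R * bd m₀) ≤ 12 := h.dist_peanoPt_a_le
    have hpb : dist (peanoPt Δ.b) (R * bd m₁) ≤ 12 := h.dist_peanoPt_b_le
    by_cases h1 : u ≤ m₀ + κ
    · -- window at `a`: edge `0 → 1`
      set τ := (u - m₀) / κ with hτ
      have hτmem : τ ∈ Icc (0 : ℝ) 1 :=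
        ⟨div_nonneg (by linarith [hu.1]) hκpos.le, by rw [div_le_one hκpos]; linarith⟩
      have hθu : Θ₀ u = (((0 : ℕ) : ℝ) + τ) / verts.length := by
        rw [hP1 u h1, hNr, Nat.cast_zero, zero_add, hτ, div_div]
      have hLu : polygonLoop verts (Θ₀ u) =
          AffineMap.lineMap (verts[0]'hNpos) (verts[(0 + 1) % verts.length]'(Nat.mod_lt _ hNpos)) τ := by
        rw [hθu]
        exact polygonLoop_apply_div hNpos hτmem
      have hidx : verts[(0 + 1) % verts.length]'(Nat.mod_lt _ hNpos) = verts[1]'(by rw [hN]; omega) :=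
        getElem_congr_idx (Nat.mod_eq_of_lt (by rw [hN]; omega))
      have hd1 : dist (polygonLoop verts (Θ₀ u)) (peanoPt Δ.a) ≤ 1 := by
        rw [hLu, hidx]
        exact dist_lineMap_le_one (by rw [hv0, dist_self]; norm_num) hv1 hτmem
      have hd2 : dist ((R : ℂ) * bd m₀) (R * bd u) ≤ 1 :=
        hwin m₀ u (by rw [abs_le]; constructor <;> linarith [hu.1])
      linarith [dist_triangle4 (polygonLoop verts (Θ₀ u)) (peanoPt Δ.a) ((R : ℂ) * bd m₀)
        ((R : ℂ) * bd u)]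
    · by_cases h2 : u ≤ m₁ - κ
      · -- along `α`: vertices `1 → k`
        have hw : 0 < m₁ - m₀ - 2 * κ := by linarith
        set t' := (u - m₀ - κ) / (m₁ - m₀ - 2 * κ) with ht'
        have ht'mem : t' ∈ Icc (0 : ℝ) 1 :=
          ⟨div_nonneg (by linarith [not_le.1 h1]) hw.le, by rw [div_le_one hw]; linarith⟩
        have ht'eq : t' * (m₁ - m₀ - 2 * κ) = u - m₀ - κ := div_mul_cancel₀ _ hw.ne'
        let sI : I := φA.symm ⟨t', ht'mem⟩
        have hFAt : FA t' = (sI : ℝ) := by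
          show ((φA.symm (Set.projIcc 0 1 zero_le_one t') : I) : ℝ) = (φA.symm ⟨t', ht'mem⟩ : ℝ)
          rw [Set.projIcc_of_mem _ ht'mem]
        have hθu : Θ₀ u = (((1 : ℕ) : ℝ) + ((αpts.length : ℝ) - 1) * (sI : ℝ)) / verts.length := by
          rw [hP2 u h1 h2, hNr, hαlen, ← ht', hFAt]
          push_cast
          ring
        have hLu : polygonLoop verts (Θ₀ u) = pathCurve αpts sI := by
          rw [hθu, polygonLoop_block hαne (by rw [hN, hαlen]; omega)
            (fun j hj ↦ Δ.boundaryVerts_getElem_one_add hj) sI.2]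
          rfl
        have hd1 : dist (polygonLoop verts (Θ₀ u)) (R * bd (m₀ + t' * (m₁ - m₀))) < 11 := by
          have := hφA sI
          rwa [show φA sI = ⟨t', ht'mem⟩ from φA.apply_symm_apply _, harcA, ← hLu] at this
        have hd2 : dist ((R : ℂ) * bd (m₀ + t' * (m₁ - m₀))) (R * bd u) ≤ 1 := by
          refine hwin _ _ ?_
          have h3 := mul_nonneg hκpos.le ht'mem.1
          have h4 := mul_le_mul_of_nonneg_left ht'mem.2 hκpos.le
          have hkt : t' * (m₁ - m₀) = u - m₀ - κ + 2 * (κ * t') := by linear_combination ht'eq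
          rw [abs_le]
          constructor <;> linarith
        linarith [dist_triangle (polygonLoop verts (Θ₀ u)) ((R : ℂ) * bd (m₀ + t' * (m₁ - m₀)))
          ((R : ℂ) * bd u)]
      · by_cases h3 : u ≤ m₁ + κ
        · -- window at `b`: edges `k → k + 1 → k + 2`
          set τ := (u - (m₁ - κ)) / κ with hτ
          have hτ0 : 0 ≤ τ := div_nonneg (by linarith [not_le.1 h2]) hκpos.le
          have hτ2 : τ ≤ 2 := by rw [hτ, div_le_iff₀ hκpos]; linarith
          have hF3 : Θ₀ u = ((k : ℝ) + τ) / verts.length := by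
            rw [hP3 u h1 h2 h3, hNr]
          have hd1 : dist (polygonLoop verts (Θ₀ u)) (peanoPt Δ.b) ≤ 1 := by
            rcases le_or_gt τ 1 with hτ1 | hτ1
            · have hLu : polygonLoop verts (Θ₀ u) = AffineMap.lineMap (verts[k]'(by rw [hN]; omega))
                  (verts[(k + 1) % verts.length]'(Nat.mod_lt _ hNpos)) τ := by
                rw [hF3]
                exact polygonLoop_apply_div (by rw [hN]; omega) ⟨hτ0, hτ1⟩
              rw [hLu, getElem_congr_idx (Nat.mod_eq_of_lt (by rw [hN]; omega)), hvk1]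
              exact dist_lineMap_le_one hvk (by rw [dist_self]; norm_num) ⟨hτ0, hτ1⟩
            · have hF3' : Θ₀ u = (((k + 1 : ℕ) : ℝ) + (τ - 1)) / verts.length := by
                rw [hF3]; push_cast; ring
              have hLu : polygonLoop verts (Θ₀ u) =
                  AffineMap.lineMap (verts[k + 1]'(by rw [hN]; omega))
                    (verts[(k + 1 + 1) % verts.length]'(Nat.mod_lt _ hNpos)) (τ - 1) := by
                rw [hF3']
                exact polygonLoop_apply_div (by rw [hN]; omega) ⟨by linarith, by linarith⟩
              rw [hLu, getElem_congr_idx (Nat.mod_eq_of_lt (by rw [hN]; omega)), hvk1]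
              have hvk2' : dist (verts[k + 1 + 1]'(by rw [hN]; omega)) (peanoPt Δ.b) ≤ 1 := by
                rw [getElem_congr_idx (show k + 1 + 1 = k + 2 by ring)]; exact hvk2
              exact dist_lineMap_le_one (by rw [dist_self]; norm_num) hvk2' ⟨by linarith, by linarith⟩
          have hd2 : dist ((R : ℂ) * bd m₁) (R * bd u) ≤ 1 := by
            refine hwin _ _ ?_
            have := not_le.1 h2
            rw [abs_le]; constructor <;> linarith
          linarith [dist_triangle4 (polygonLoop verts (Θ₀ u)) (peanoPt Δ.b) ((R : ℂ) * bd m₁)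
            ((R : ℂ) * bd u)]
        · by_cases h4 : u ≤ m₀ + 1 - κ
          · -- along `β` backwards: vertices `k + 2 → k + m + 1`
            have hw : 0 < m₀ + 1 - m₁ - 2 * κ := by linarith
            set t' := (u - m₁ - κ) / (m₀ + 1 - m₁ - 2 * κ) with ht'
            have ht'mem : t' ∈ Icc (0 : ℝ) 1 :=
              ⟨div_nonneg (by linarith [not_le.1 h3]) hw.le, by rw [div_le_one hw]; linarith⟩
            have ht'eq : t' * (m₀ + 1 - m₁ - 2 * κ) = u - m₁ - κ := div_mul_cancel₀ _ hw.ne'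
            let sI : I := φB.symm ⟨t', ht'mem⟩
            have hFBt : FB t' = (sI : ℝ) := by
              show ((φB.symm (Set.projIcc 0 1 zero_le_one t') : I) : ℝ) = (φB.symm ⟨t', ht'mem⟩ : ℝ)
              rw [Set.projIcc_of_mem _ ht'mem]
            have hθu : Θ₀ u =
                (((k + 2 : ℕ) : ℝ) + ((βr.length : ℝ) - 1) * (sI : ℝ)) / verts.length := by
              rw [hP4 u h1 h2 h3 h4, hNr, hβlen, ← ht', hFBt]
              push_cast
              ring
            have hLu : polygonLoop verts (Θ₀ u) = pathCurve βr sI := by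
              rw [hθu, polygonLoop_block hβne (by rw [hN, hβlen]; omega)
                (fun j hj ↦ Δ.boundaryVerts_getElem_add_two_add hj) sI.2]
              rfl
            have hd1 : dist (polygonLoop verts (Θ₀ u)) (R * bd (m₁ + t' * (m₀ + 1 - m₁))) < 11 := by
              have := hφB sI
              rwa [show φB sI = ⟨t', ht'mem⟩ from φB.apply_symm_apply _, harcB, ← hLu] at this
            have hd2 : dist ((R : ℂ) * bd (m₁ + t' * (m₀ + 1 - m₁))) (R * bd u) ≤ 1 := by
              refine hwin _ _ ?_
              have h5 := mul_nonneg hκpos.le ht'mem.1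
              have h6 := mul_le_mul_of_nonneg_left ht'mem.2 hκpos.le
              have hkt : t' * (m₀ + 1 - m₁) = u - m₁ - κ + 2 * (κ * t') := by
                linear_combination ht'eq
              rw [abs_le]
              constructor <;> linarith
            linarith [dist_triangle (polygonLoop verts (Θ₀ u))
              ((R : ℂ) * bd (m₁ + t' * (m₀ + 1 - m₁))) ((R : ℂ) * bd u)]
          · -- window at `a` again: edge `k + m + 1 → 0`
            set τ := (u - (m₀ + 1 - κ)) / κ with hτ
            have hτmem : τ ∈ Icc (0 : ℝ) 1 :=
              ⟨div_nonneg (by linarith [not_le.1 h4]) hκpos.le,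
                by rw [div_le_one hκpos]; linarith [hu.2]⟩
            have hF5 : Θ₀ u = (((k + m + 1 : ℕ) : ℝ) + τ) / verts.length := by
              rw [hP5 u h1 h2 h3 h4, hNr]
              push_cast
              ring
            have hLu : polygonLoop verts (Θ₀ u) =
                AffineMap.lineMap (verts[k + m + 1]'(by rw [hN]; omega))
                  (verts[(k + m + 1 + 1) % verts.length]'(Nat.mod_lt _ hNpos)) τ := by
              rw [hF5]
              exact polygonLoop_apply_div (by rw [hN]; omega) hτmem
            have hidx : verts[(k + m + 1 + 1) % verts.length]'(Nat.mod_lt _ hNpos) = verts[0]'hNpos :=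
              getElem_congr_idx (by rw [hN, show k + m + 1 + 1 = k + m + 2 by ring, Nat.mod_self])
            have hd1 : dist (polygonLoop verts (Θ₀ u)) (peanoPt Δ.a) ≤ 1 := by
              rw [hLu, hidx]
              exact dist_lineMap_le_one hvN1 (by rw [hv0, dist_self]; norm_num) hτmem
            have hd2 : dist ((R : ℂ) * bd m₀) (R * bd u) ≤ 1 := by
              rw [← hbd1]
              refine hwin _ _ ?_
              have := not_le.1 h4
              rw [abs_le]; constructor <;> linarith [hu.2]
            linarith [dist_triangle4 (polygonLoop verts (Θ₀ u)) (peanoPt Δ.a) ((R : ℂ) * bd m₀)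
              ((R : ℂ) * bd u)]
  -- ### the Jordan domain
  have hc0 : ((R⁻¹ : ℝ) : ℂ) ≠ 0 := by exact_mod_cast (inv_pos.2 hRpos).ne'
  have hfr : frontier Δ.carrier = range (polygonLoop verts) := Δ.frontier_carrier
  refine ⟨{ carrier := (fun z : ℂ ↦ ((R⁻¹ : ℝ) : ℂ) * z) '' Δ.carrier
            boundary := fun t ↦ ((R⁻¹ : ℝ) : ℂ) * polygonLoop verts (Θ t)
            isOpen := (Homeomorph.mulLeft₀ ((R⁻¹ : ℝ) : ℂ) hc0).isOpenMap _ Δ.isOpen_carrier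
            isBounded := ?_
            isConnected := Δ.isConnected_carrier.image _ (continuous_const.mul continuous_id).continuousOn
            continuous_boundary := continuous_const.mul ((continuous_polygonLoop verts).comp hΘc)
            periodic_boundary := fun t ↦ by
              show ((R⁻¹ : ℝ) : ℂ) * polygonLoop verts (Θ (t + 1)) = ((R⁻¹ : ℝ) : ℂ) * polygonLoop verts (Θ t)
              rw [hΘ1, periodic_polygonLoop]
            injOn_boundary := fun s hs t ht hst ↦ by
              have h01 : Θ 1 = Θ 0 + 1 := by simpa using hΘ1 0
              have hs' : Θ s ∈ Ico (Θ 0) (Θ 0 + 1) :=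
                ⟨hΘm.monotone hs.1, by rw [← h01]; exact hΘm hs.2⟩
              have ht' : Θ t ∈ Ico (Θ 0) (Θ 0 + 1) :=
                ⟨hΘm.monotone ht.1, by rw [← h01]; exact hΘm ht.2⟩
              have heq : polygonLoop verts (Θ s) = polygonLoop verts (Θ t) := mul_left_cancel₀ hc0 hst
              exact hΘm.injective (Δ.toJordanDomain.injOn_boundary_Ico (Θ 0) hs' ht' heq)
            range_boundary := by
              rw [show (fun t ↦ ((R⁻¹ : ℝ) : ℂ) * polygonLoop verts (Θ t)) =
                  (fun z : ℂ ↦ ((R⁻¹ : ℝ) : ℂ) * z) ∘ (polygonLoop verts ∘ Θ) from rfl,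
                Set.range_comp, Set.range_comp, hΘs.range_eq, Set.image_univ, ← hfr]
              exact (Homeomorph.mulLeft₀ ((R⁻¹ : ℝ) : ℂ) hc0).image_frontier Δ.carrier }, rfl,
    fun t ↦ ?_⟩
  · -- boundedness of the dilated carrier
    obtain ⟨M, hM⟩ := Δ.isBounded_carrier.subset_closedBall 0
    refine (isBounded_closedBall (x := (0 : ℂ)) (r := R⁻¹ * M)).subset ?_
    rintro _ ⟨z, hz, rfl⟩
    have := mem_closedBall_zero_iff.1 (hM hz)
    rw [mem_closedBall_zero_iff, norm_mul, Complex.norm_real, Real.norm_of_nonneg (inv_pos.2 hRpos).le]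
    exact mul_le_mul_of_nonneg_left this (inv_pos.2 hRpos).le
  -- the estimate: reduce to the fundamental period
  show dist (((R⁻¹ : ℝ) : ℂ) * polygonLoop verts (Θ t)) (bd t) ≤ 14 / R
  set u := m₀ + Int.fract (t - m₀) with hu
  have humem : u ∈ Icc m₀ (m₀ + 1) :=
    ⟨by linarith [Int.fract_nonneg (t - m₀)], by linarith [Int.fract_lt_one (t - m₀)]⟩
  have hΘt : Θ t = ⌊t - m₀⌋ + Θ₀ u := rfl
  have hLt : polygonLoop verts (Θ t) = polygonLoop verts (Θ₀ u) := by
    rw [hΘt, add_comm]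
    have := (periodic_polygonLoop verts).int_mul ⌊t - m₀⌋ (Θ₀ u)
    rwa [mul_one] at this
  have hbdt : bd t = bd u := by
    have e : t = u + (⌊t - m₀⌋ : ℝ) := by
      rw [hu]; have := Int.floor_add_fract (t - m₀); linarith
    rw [e]
    have := D.toMarkedDomain.periodic_boundary.int_mul ⌊t - m₀⌋ u
    rwa [mul_one] at this
  rw [hLt, hbdt]
  have e : bd u = ((R⁻¹ : ℝ) : ℂ) * ((R : ℂ) * bd u) := by
    rw [← mul_assoc]
    push_cast
    rw [inv_mul_cancel₀ (by exact_mod_cast hRpos.ne'), one_mul]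
  rw [e, dist_ofReal_mul, abs_of_pos (inv_pos.2 hRpos)]
  calc R⁻¹ * dist (polygonLoop verts (Θ₀ u)) ((R : ℂ) * bd u) ≤ R⁻¹ * 14 :=
        mul_le_mul_of_nonneg_left (hmain u humem) (inv_pos.2 hRpos).le
    _ = 14 / R := by ring

end MatchedLoop

end USTPeano
end Literature.Probability.RandomPlanarGeometry
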